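import Summits.Ventures.HodgeRepro2.T5BergmanCoefficient

/-!
# The Bergman pairing: the norm of the lowest-weight vector for every weight, and positivity

For the weight-`k` Bergman pairing `⟨f₁, f₂⟩_k = ∫_𝔻 f₁ f̄₂ (1 - |z|²)^{k-2} dA` of
`T5BergmanCoefficient` (`k ≥ 2`):

* `⟨1, 1⟩_k = ∫_𝔻 (1 - |z|²)^{k-2} dA = π / (k - 1)` (polar coordinates; `π/2` at `k = 3` as in
  `pairing_lowest_lowest_three`);
* `⟨f, f⟩_k = ∫_𝔻 |f|² (1 - |z|²)^{k-2} dA` is real and non-negative for every `f`.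

Consequently the lowest-weight matrix coefficient `⟨π_k(g) 1, 1⟩_k = a^{-k} π/(k-1)`
(`pairing_act_lowest`) is explicit for EVERY weight `k ≥ 2`.

Blind lane: Mathlib + the HodgeRepro2 prefix only; no sorry; axioms ⊆ {propext, Classical.choice,
Quot.sound}.
-/

namespace Summit.Ventures.HodgeRepro2.T5BergmanPairing

open MeasureTheory MeasureTheory.Measure Metric T5BergmanCoefficient
open scoped Real

/-! ### The radial integral -/

/-- `d/dr [-(1 - r²)^{m+1} / (2(m+1))] = r (1 - r²)^m`. -/
lemma hasDerivAt_radial (m : ℕ) (r : ℝ) :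
    HasDerivAt (fun r : ℝ => -(1 - r ^ 2) ^ (m + 1) / (2 * ((m : ℝ) + 1)))
      (r * (1 - r ^ 2) ^ m) r := by
  have h1 : HasDerivAt (fun r : ℝ => 1 - r ^ 2) (-(2 * r)) r :=
    ((hasDerivAt_pow 2 r).const_sub 1).congr_deriv (by norm_num)
  have hm : (2 * ((m : ℝ) + 1)) ≠ 0 := by positivity
  refine ((h1.pow (m + 1)).neg.div_const (2 * ((m : ℝ) + 1))).congr_deriv ?_
  rw [Nat.add_sub_cancel]
  field_simp
  push_cast
  ring

/-- `∫_0^1 r (1 - r²)^m dr = 1 / (2(m+1))`. -/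
theorem integral_Ioo_mul_pow (m : ℕ) :
    ∫ r in Set.Ioo (0 : ℝ) 1, r * (1 - r ^ 2) ^ m = 1 / (2 * ((m : ℝ) + 1)) := by
  rw [← integral_Ioc_eq_integral_Ioo, ← intervalIntegral.integral_of_le zero_le_one,
    intervalIntegral.integral_eq_sub_of_hasDerivAt (fun r _ => hasDerivAt_radial m r)
      ((by fun_prop : Continuous fun r : ℝ => r * (1 - r ^ 2) ^ m).intervalIntegrable 0 1)]
  have hm1 : ((m : ℝ) + 1) ≠ 0 := by positivity
  norm_num
  field_simp

/-! ### The norm of the lowest-weight vector for every weight -/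

/-- **`⟨1, 1⟩_k = π / (k - 1)`** for `k ≥ 2` — the squared norm of the lowest-weight vector of the
weight-`k` model (`= π/2` at `k = 3`). -/
theorem pairing_lowest_lowest (k : ℕ) (hk : 2 ≤ k) :
    pairing k lowest lowest = ((π / ((k : ℝ) - 1) : ℝ) : ℂ) := by
  obtain ⟨m, rfl⟩ := Nat.exists_eq_add_of_le' hk
  unfold pairing
  simp only [lowest, map_one, mul_one, one_mul, show m + 2 - 2 = m by omega]
  rw [integral_ball_radial (fun r => (1 - r ^ 2) ^ m) (by fun_prop)]
  have e : ∀ r : ℝ, ((r : ℂ) * (((1 - r ^ 2) ^ m : ℝ) : ℂ)) = (((r * (1 - r ^ 2) ^ m : ℝ)) : ℂ) := by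
    intro r
    push_cast
    ring
  simp_rw [e]
  rw [integral_complex_ofReal, integral_Ioo_mul_pow m]
  push_cast
  have hm1c : ((m : ℂ) + 1) ≠ 0 := by exact_mod_cast Nat.succ_ne_zero m
  rw [show ((m : ℂ) + 2 - 1) = (m : ℂ) + 1 by ring]
  field_simp

/-- The lowest-weight matrix coefficient for every weight: `⟨π_k(g) 1, 1⟩_k = a^{-k} · π/(k-1)`. -/
theorem pairing_act_lowest_eq (k : ℕ) (hk : 2 ≤ k) (g : T5SU11Unimodular.SU11) :
    pairing k (act k g lowest) lowest = (mat g 0 0)⁻¹ ^ k * ((π / ((k : ℝ) - 1) : ℝ) : ℂ) := by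
  rw [pairing_act_lowest, pairing_lowest_lowest k hk]

/-! ### Positivity -/

/-- `⟨f, f⟩_k = ∫_𝔻 |f|² (1 - |z|²)^{k-2} dA` (a real number). -/
theorem pairing_self_eq (k : ℕ) (f : ℂ → ℂ) :
    pairing k f f = ((∫ z in ball (0 : ℂ) 1, ‖f z‖ ^ 2 * (1 - ‖z‖ ^ 2) ^ (k - 2) : ℝ) : ℂ) := by
  unfold pairing
  rw [← integral_complex_ofReal]
  congr 1
  ext z
  rw [Complex.mul_conj, Complex.normSq_eq_norm_sq]
  push_cast
  ring

/-- `⟨f, f⟩_k` is real and non-negative. -/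
theorem pairing_self_nonneg (k : ℕ) (f : ℂ → ℂ) :
    0 ≤ (pairing k f f).re ∧ (pairing k f f).im = 0 := by
  rw [pairing_self_eq]
  refine ⟨?_, Complex.ofReal_im _⟩
  rw [Complex.ofReal_re]
  apply setIntegral_nonneg measurableSet_ball
  intro z hz
  have h1 : 0 ≤ 1 - ‖z‖ ^ 2 := by
    have := mem_ball_zero_iff.mp hz
    nlinarith [norm_nonneg z]
  positivity

end Summit.Ventures.HodgeRepro2.T5BergmanPairing
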